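import Mathlib.Combinatorics.SimpleGraph.Connectivity.Connected
import Mathlib.GroupTheory.Index
import Literature.AnabelianGeometry.SemiGraphs.SubdivisionLemmas
import Literature.AnabelianGeometry.Anabelioids.Basic
import Literature.AnabelianGeometry.Anabelioids.FiberFunctorUnique
import HarnessLib

/-!
# Tools for the vertex case of [SemiAnbd] Proposition 2.6 (Commensurability)

Mochizuki, *Semi-graphs of anabelioids*, Publ. RIMS **42** (2006), proof of Proposition 2.6, author's
manuscript pp. 28–29 [cite: MochizukiSemiAnbd2006, Prop. 2.6 pp.28-29].  Three small inputs of
the vertex case, proved here once so that the main file stays readable (proof-only, no definitions):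

* `SemiGraph.isConnected_of_isIso`, `SemiGraph.vertexMap_injective_of_isIso` — an approximator
  `𝒢 → 𝒢′` "induces an isomorphism on underlying semi-graphs" (Def. 2.3 (ii)); hence `𝒢′` is
  connected when `𝒢` is, and distinct vertices stay distinct;
* `finsetCard_le_relIndex_of_stabilizer` — the counting step of p. 29: if `Δ ⊆ Γ`-ish has finite index
  `[Γ : Γ ∩ Δ] = m` and every element of `Δ` that fixes one point of a `Γ`-set `S` fixes all of `S`
  ("`Π″_𝕂 ∩ Π″_ℍ` also acts freely on `S`"), then any family of elements of `Γ` fixing a point `s` and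
  acting pairwise differently on `S` has at most `m` members ("the isotropy subgroup … has order
  `≤ [Π″_ℍ : Π″_𝕂 ∩ Π″_ℍ] < M`");
* `conjAut_smul_app` — change of basepoint: along an isomorphism of functors `e : F ≅ F′` the
  bijections `e_X : F(X) ≃ F′(X)` intertwine `σ ∈ Aut F` with `e σ e⁻¹ ∈ Aut F′` ([GeoAn] §1.1: the
  fundamental group is independent of the basepoint up to inner automorphism).

Seat abc-iut-L6-t18 (abc-iut cell; division of Prop. 2.6 with abc-iut-L3-d1, 2026-08-25).
-/

namespace Literature.AnabelianGeometry.SemiGraphs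

open CategoryTheory

universe w u

/-! ### Isomorphisms of semi-graphs -/

namespace SemiGraph

variable {G G' : SemiGraph.{u}}

/-- An isomorphism of semi-graphs is injective (indeed bijective) on vertices.
[cite: MochizukiSemiAnbd2006, Def. 2.3(ii) p.25] -/
theorem vertexMap_injective_of_isIso (φ : G ⟶ G') [IsIso φ] : Function.Injective φ.vertexMap := by
  have h : (φ ≫ inv φ).vertexMap = id := by rw [IsIso.hom_inv_id, id_vertexMap]
  rw [comp_vertexMap] at h
  exact Function.LeftInverse.injective (g := (inv φ).vertexMap) fun v => congrFun h v

/-- An isomorphism of semi-graphs is surjective on the nodes of the barycentric subdivisions.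
[cite: MochizukiSemiAnbd2006, Def. 2.3(ii) p.25] -/
theorem nodeMap_surjective_of_isIso (φ : G ⟶ G') [IsIso φ] :
    Function.Surjective (Sum.map φ.vertexMap (Sum.map φ.edgeMap φ.branchMap) : G.Node → G'.Node) := by
  have hv : φ.vertexMap ∘ (inv φ).vertexMap = id := by
    rw [← comp_vertexMap, IsIso.inv_hom_id, id_vertexMap]
  have he : φ.edgeMap ∘ (inv φ).edgeMap = id := by
    rw [← comp_edgeMap, IsIso.inv_hom_id, id_edgeMap]
  have hb : φ.branchMap ∘ (inv φ).branchMap = id := by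
    rw [← comp_branchMap, IsIso.inv_hom_id, id_branchMap]
  intro y
  rcases y with v | e | b
  · refine ⟨Sum.inl ((inv φ).vertexMap v), ?_⟩
    change Sum.inl (φ.vertexMap ((inv φ).vertexMap v)) = Sum.inl v
    exact congrArg Sum.inl (congrFun hv v)
  · refine ⟨Sum.inr (Sum.inl ((inv φ).edgeMap e)), ?_⟩
    change Sum.inr (Sum.inl (φ.edgeMap ((inv φ).edgeMap e))) = Sum.inr (Sum.inl e)
    exact congrArg (fun z => Sum.inr (Sum.inl z)) (congrFun he e)
  · refine ⟨Sum.inr (Sum.inr ((inv φ).branchMap b)), ?_⟩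
    change Sum.inr (Sum.inr (φ.branchMap ((inv φ).branchMap b))) = Sum.inr (Sum.inr b)
    exact congrArg (fun z => Sum.inr (Sum.inr z)) (congrFun hb b)

/-- **Connectedness is invariant under isomorphisms of semi-graphs** (the node map of an isomorphism
is a surjective homomorphism of barycentric subdivisions). [cite: MochizukiSemiAnbd2006, §1 pp.11-13] -/
theorem isConnected_of_isIso (φ : G ⟶ G') [IsIso φ] (h : G.IsConnected) : G'.IsConnected := by
  let f : G.subdivision →g G'.subdivision :=
    ⟨Sum.map φ.vertexMap (Sum.map φ.edgeMap φ.branchMap), fun h => subdivision_adj_map φ h⟩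
  exact ⟨h.connected.map f (nodeMap_surjective_of_isIso φ)⟩

end SemiGraph

/-! ### The counting step ([SemiAnbd] p. 29) -/

/-- **Counting step of [SemiAnbd] Prop. 2.6, p. 29**: let `Γ` act on `S`, let `Δ` be a subgroup
every element of which fixing some point of `S` fixes every point ("acts freely" modulo the kernel),
with `[Γ : Γ ∩ Δ] = m ≠ 0`.  Then a finite family `E ⊆ Γ` of elements fixing a point `s` and acting
pairwise differently on `S` has at most `m` members: `γ ↦ γ(Γ ∩ Δ)` is injective on `E`, since
`γ⁻¹γ′ ∈ Δ` fixes `s`, hence acts trivially. [cite: MochizukiSemiAnbd2006, Prop. 2.6 p.29] -/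
theorem finsetCard_le_relIndex_of_stabilizer {G : Type*} [Group G] {S : Type*} [MulAction G S]
    (Γ Δ : Subgroup G) (hΔ : ∀ δ ∈ Δ, (∃ s : S, δ • s = s) → ∀ t : S, δ • t = t)
    (hidx : Δ.relIndex Γ ≠ 0) (s : S) (E : Finset G) (hEΓ : ∀ γ ∈ E, γ ∈ Γ)
    (hEs : ∀ γ ∈ E, γ • s = s)
    (hE : ∀ γ ∈ E, ∀ γ' ∈ E, (∀ t : S, γ • t = γ' • t) → γ = γ') :
    E.card ≤ Δ.relIndex Γ := by
  classical
  haveI : (Δ.subgroupOf Γ).FiniteIndex := ⟨hidx⟩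
  -- the map to the cosets of `Γ ∩ Δ` in `Γ`
  let f : E → Γ ⧸ Δ.subgroupOf Γ := fun γ => QuotientGroup.mk ⟨γ.1, hEΓ γ.1 γ.2⟩
  have hf : Function.Injective f := by
    rintro ⟨γ, hγ⟩ ⟨γ', hγ'⟩ hq
    have hmem : (⟨γ, hEΓ γ hγ⟩ : Γ)⁻¹ * ⟨γ', hEΓ γ' hγ'⟩ ∈ Δ.subgroupOf Γ := QuotientGroup.eq.mp hq
    rw [Subgroup.mem_subgroupOf] at hmem
    change γ⁻¹ * γ' ∈ Δ at hmem
    have hfix : (γ⁻¹ * γ') • s = s := by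
      rw [mul_smul, hEs γ' hγ']
      exact inv_smul_eq_iff.mpr (hEs γ hγ).symm
    have hall := hΔ _ hmem ⟨s, hfix⟩
    refine Subtype.ext (hE γ hγ γ' hγ' fun t => ?_)
    have ht := hall t
    rw [mul_smul] at ht
    have := congrArg (fun u => γ • u) ht
    simpa using this.symm
  have hcard := Nat.card_le_card_of_injective f hf
  rw [Nat.card_eq_fintype_card, Fintype.card_coe] at hcard
  rwa [Subgroup.relIndex, Subgroup.index_eq_card]

/-! ### Change of basepoint -/

section Basepoint

variable {C : Type*} [Category C]

/-- Along an isomorphism of functors `e : F ≅ F'`, the bijections `e_X : F(X) → F'(X)` intertwine the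
action of `σ ∈ Aut F` with that of `e σ e⁻¹ ∈ Aut F'` ([GeoAn] §1.1: independence of the basepoint
up to inner automorphism). [cite: MochizukiGeoAn2004, §1.1 p.10] -/
theorem conjAut_smul_app {F F' : C ⥤ FintypeCat.{w}} (e : F ≅ F') (σ : Aut F) (X : C)
    (x : F.obj X) : (e.conjAut σ) • (e.hom.app X x) = e.hom.app X (σ • x) := by
  rw [PreGaloisCategory.mulAction_def, PreGaloisCategory.mulAction_def, Iso.conjAut_hom,
    Iso.conj_apply, NatTrans.comp_app, NatTrans.comp_app, FintypeCat.comp_apply,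
    FintypeCat.comp_apply, ← FintypeCat.comp_apply (e.hom.app X) (e.inv.app X), e.hom_inv_id_app,
    FintypeCat.id_apply]

/-- The components of an isomorphism of `FintypeCat`-valued functors are bijections.
[cite: MochizukiGeoAn2004, §1.1 p.10] -/
theorem bijective_hom_app {F F' : C ⥤ FintypeCat.{w}} (e : F ≅ F') (X : C) :
    Function.Bijective (e.hom.app X) :=
  (FintypeCat.equivEquivIso.symm (e.app X)).bijective

/-- Transport of "an automorphism fixing one point of the fibre fixes every point" along an
isomorphism of functors. [cite: MochizukiGeoAn2004, §1.1 p.10] -/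
theorem forall_smul_eq_of_iso {F F' : C ⥤ FintypeCat.{w}} (e : F ≅ F') (X : C)
    (h : ∀ σ' : Aut F', (∃ x' : F'.obj X, σ' • x' = x') → ∀ y' : F'.obj X, σ' • y' = y')
    (σ : Aut F) (hσ : ∃ x : F.obj X, σ • x = x) (y : F.obj X) : σ • y = y := by
  obtain ⟨x, hx⟩ := hσ
  have h1 : (e.conjAut σ) • (e.hom.app X x) = e.hom.app X x := by rw [conjAut_smul_app, hx]
  have h2 := h (e.conjAut σ) ⟨_, h1⟩ (e.hom.app X y)
  rw [conjAut_smul_app] at h2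
  exact (bijective_hom_app e X).1 h2

end Basepoint

/-! ### Basepoints with values in any universe -/

section FiberUniverse

open Literature.AnabelianGeometry.Anabelioids

universe w' u₂' u₁'

variable {C : Type u₁'} [Category.{u₂'} C] [GaloisCategory C]

/-- [SGA1] V 5.7 for fibre functors with values in finite sets of ANY universe: any two fibre
functors `F, G : C ⥤ FintypeCat.{w}` of a Galois category are isomorphic (reduction to the tree's
`nonempty_iso_of_fiberFunctor` along Mathlib's universe switch `FintypeCat.uSwitchEquivalence`; needed
for the basepoints `ρ_v ⋙ β` of `B(𝒢)`, whose hom-universe exceeds that of the constituents).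
[cite: SGA1, Exp. V Cor. 5.7] -/
theorem nonempty_iso_of_fiberFunctor' (F G : C ⥤ FintypeCat.{w'}) [PreGaloisCategory.FiberFunctor F]
    [PreGaloisCategory.FiberFunctor G] : Nonempty (F ≅ G) := by
  let e : FintypeCat.{w'} ≌ FintypeCat.{u₂'} := FintypeCat.uSwitchEquivalence.{w', u₂'}
  haveI : PreGaloisCategory.FiberFunctor (F ⋙ e.functor) :=
    PreGaloisCategory.FiberFunctor.comp_right _
  haveI : PreGaloisCategory.FiberFunctor (G ⋙ e.functor) :=
    PreGaloisCategory.FiberFunctor.comp_right _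
  obtain ⟨i⟩ := nonempty_iso_of_fiberFunctor (F ⋙ e.functor) (G ⋙ e.functor)
  exact ⟨(Functor.rightUnitor F).symm ≪≫ Functor.isoWhiskerLeft F e.unitIso ≪≫
    (Functor.associator _ _ _).symm ≪≫ Functor.isoWhiskerRight i e.inverse ≪≫
    Functor.associator _ _ _ ≪≫ Functor.isoWhiskerLeft G e.unitIso.symm ≪≫ Functor.rightUnitor G⟩

end FiberUniverse

end Literature.AnabelianGeometry.SemiGraphs
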